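/-
Copyright (c) 2026 the pub-hodgecm-mathlib formalisation cell (harness21).  Prover seat hodgecm-mathlib-LH4-p04 (g6), req620 Track A «(D-RAM) FOUR-FRAME» squad
(STAGE-1b pre-scoping, heir LEAD F0P3a-plan (g20) T19-24 clause; dealer LH4-plan (g12) WORD #36 «(T5-P-RamM) the type-RamM third of the row-(2) type-(2) population
table», co-hand under LH4-p07 (g8)'s row-(2) lead), 2026-09-04.
-/
import Summits.HodgeConjecture.HodgeConjecture.Theorems.F0P3cDyRamToricLevelCensusRamMDep   -- ★ p857418∕p857497 head + ★ (D0)(D1)(D2) `dep_iff_of_witness_ramified`, `levelSetDep_eq_of_generic_ramified` (LH4-p06 (g4)); brings ★ DEFS `levelSet ∕ levelSetDep ∕ IsOrd ∕ dualGen`, ★ T4 `QuadraticOrder*`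
import HarnessLib

/-!
# T5c-P (RamM): TWO-MULTIPLIER cells of the depth-refined toric level census REDUCE to ONE-MULTIPLIER cells behind a lattice-free guard
# `levelSetDep(j,a;μ₁) ∩ levelSetDep(j,a;μ₂) = [j + a ≤ m₂ ∨ |ρμ₁∕μ₁ − ρμ₂∕μ₂| ≤ exp(2m₂ − 2a − 2j − d_ρ)] · levelSetDep(j,a;μ₁)`  (`|μ₁| = |ϖE|^{m₁} ≥ |μ₂| = |ϖE|^{m₂}`)

Cell `hodgecm-mathlib` (D-0151), FLOOR 0, crux item H413 = `stmt-HodgeConjecture-24833`, route of record `HCCMUnconditional`; squad F0∕P3c∕LH4; lane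
`--supports stmt-HodgeConjecture-24833 --as helper` (count-neutral; pays NO tier-0 row; the STAGE-1b rows `stub_rows_transvPlus ∕ transvMinus ∕ regular` stay OPEN).
THEOREMS ONLY (no `def`, no instance, no notation, no `sorry`, default heartbeats).  STAGE-1b TYPED INVENTORY for the chair's PLAN-T1 v19, row (2) column.

THE OBJECT.  After ★ p858649 the STAGE-1b debt is `PieceRowsWild` of the `T₊`-labelled shell piece and of the UNLABELLED congruence pieces `𝟙{u ∈ K ∧ X ∈ ϖ^a M₃ ∧ X² ∈ ϖ^b M₃}`,
`𝟙{u ∈ K ∧ X² ∈ ϖ^b M₃}` (`X = ι_w u − 1`).  On ROW (2) (the TYPE-(2) population: no eigenvalue root at `w`, elliptic torus through the third field `M = E′·L_w`) the G-side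
is a count of `Γ`-fixed self-dual lattices with LEVEL TOKENS (LH4-p07 (g8) PRESCOPE-type2-rows §2 (L2)(L3); ★ p858811 (C1-P) part 1): in the M-letters of the ★ (ρ2b′-X)
chain (★ (C1) p857559, ★ DEFS `F0P3cDyRamToricCensusDefs`) the depth-`a` token is ONE multiplier at a shifted argument — `levelSetDep(j, b; μ∕ϖ^a)`, the ★ one-multiplier tables
VERBATIM — while the SQUARE token `(Γ − 1)²·M ⊆ ϖ^b·M` brings a SECOND multiplier `μ″ = μ(μ + 2(u − 1))∕ϖ^b` next to the first: the cells of row (2) are the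
TWO-MULTIPLIER CELLS `levelSetDep(j, a; μ₁) ∩ {Λ ∣ μ₂·Λ^♯ ⊆ Λ} = levelSetDep(j, a; μ₁) ∩ levelSetDep(j, a; μ₂)` (PRESCOPE-type2-rows §4 (T5-P): «two-multiplier ∕
mixed-conductor toric level tables and sums, ×3 third-field types — the new science of row (2)»).

WHAT THIS FILE PROVES (type RamM: `M ∕ E` RAMIFIED, tokens `|ϖE| = exp(−2)`, `ρϖE = ϖE`, `|μᵢ| = |ϖE|^{mᵢ}`, the ★ ramified datum `(ρ, α, d_ρ)`, `Θ` an isometric involution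
commuting with `ρ`, `h ≠ 0` — EXACTLY the frame of ★ T5c `…ToricLevelCensusRamMDep`):  **AT TYPE RamM THERE IS NO NEW TABLE.**  On every level stratum `levelSet(j, a)` the
two-multiplier cell is the ONE-multiplier cell of the SHALLOWER multiplier (`m₁ ≤ m₂`, i.e. `|μ₁| ≥ |μ₂|`: the binding constraint) or EMPTY, according to a guard that does
not see the lattice — `j + a ≤ m₂` (the deeper clause is automatic) or `|ρμ₁∕μ₁ − ρμ₂∕μ₂| ≤ exp(2m₂ − 2a − 2j − d_ρ)` (the two `ρ`-twists agree to the deeper clause's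
precision):
* §1 `v_depthUnit_sub_map_eq_twist_ramified` — the `ρ`-depth of the depth unit `zᵢ = μᵢ∕(y·ϖE^{mᵢ−a})` is `|θ + ρμᵢ∕μᵢ|`, `θ = (ρh∕h)·(ρN∕N)` the LATTICE's twist
  (`N = x₀Θx₀`, `ρy = −θy`; ★ `map_hermGen_eq_neg_mul`, ★ `div_sub_map_div_eq`) — ★ RamMDep's `v_depthUnit_sub_map_eq_ramified` (1) WITHOUT the `jλ` token.
* §2 `dep_and_dep_iff_of_witness_ramified` — u-free, on a presented member `Λ = x₀·𝒪_j` of `levelSet(j, a)`: `DEP(μ₁) ∧ DEP(μ₂) ⟺ DEP(μ₁) ∧ GUARD` (★ (D0)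
  `dep_iff_of_witness_ramified` twice: both clauses constrain the SAME `θ` to closed balls `|θ + κᵢ| ≤ exp(2mᵢ − 2a − 2j − d_ρ)` of NESTED radii; two ultrametric balls
  are nested or disjoint — `Valuation.map_add`∕`map_sub`).
* §3 `levelSetDep_inter_levelSetDep_eq_ramified` (set form, `= if GUARD then levelSetDep(j,a;μ₁) else ∅`), the literal (T5-P) spelling `levelSetDep_inter_depth_eq_ramified`
  (`∩ {Λ ∣ μ₂·Λ^♯ ⊆ Λ}`), and the counted form `ncard_levelSetDep_inter_eq_ramified`; §4 `ncard_levelSetDep_inter_eq_of_generic_ramified` — composed with ★ (D1)(D2)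
  `levelSetDep_eq_of_generic_ramified`: off the coincidence diagonal of `μ₁` the two-multiplier count is `[GUARD]·[GEN(μ₁)]·#levelSet(j,a)` (★ `+` table `ncard_levelSet_eq_hnP`);
  on it, `[GUARD]·`(★ (D3) top cells of `μ₁`, `…RamMTop*`).
* §5 `map_div_sub_map_div_of_fixed` ∕ `v_twist_sub_twist_eq` — the GUARD LETTER for the pair of record `(μ₁, μ₂) = (μ∕c, μ·ν∕c′)` with `c, c′` `ρ`-fixed (powers of `ϖE`):
  `ρμ₁∕μ₁ − ρμ₂∕μ₂ = (ρμ∕μ)·(1 − ρν∕ν)`, so `|ρμ₁∕μ₁ − ρμ₂∕μ₂| = |ν − ρν| ∕ |ν|` — a token of `γ_H` alone (`ν = μ + 2(u − 1)` for the square clause).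
READING for the directive (inventory, not a claim about rows): the «×3 L» line item (T5-P) of PRESCOPE-type2-rows §4 costs, at type RamM, ONE guard letter per cell and NO census
beyond ★ T5c; the type-U ∕ type-RamK twins are the same two-ball argument over ★ `…ToricLevelCensusUnrDep` ∕ the RamK (D0) (not typed here: one hand per statement).
HONEST LABEL.  Count-neutral lattice bookkeeping over ★ organs; nothing printed is asserted; no census law is stated; `HC_CM` is proved only modulo the 7 printed citations (2 remaining
named inputs: hLiu418 = `stmt-HodgeConjecture-24832`, h413 = `stmt-HodgeConjecture-24833`) until rung 0 closes.

## References
* [Kottwitz1986BaseChangeUnits] R. E. Kottwitz, *Base change for unit elements of Hecke algebras*, Compositio Math. 60 (1986): §1 pp. 240–241 (orbital integrals of units as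
  fixed-lattice counts; the tube ∕ depth condition `μ·Λ^♯ ⊆ Λ`).
* [Jacobowitz1962] R. Jacobowitz, *Hermitian forms over local fields*, Amer. J. Math. 84 (1962): §4 (dual lattices `Λ^♯ = y⁻¹Λ`, modular components).
* [Serre1979] J.-P. Serre, *Local Fields*, GTM 67 (1979): Ch. II §1 (the ultrametric inequality: two balls are nested or disjoint), Ch. III §6 Prop. 12 (orders of conductor `c`).
* [Flicker1998UnitaryFL] Y. Z. Flicker, *Elementary proof of the fundamental lemma for a unitary group*, Canad. J. Math. 50 (1998): Prop. 7 p. 84 (the level tables).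
-/

set_option autoImplicit false

noncomputable section

namespace Summit.HodgeConjecture.HodgeConjecture.Cruxes.H413.F0P3cDyRamToricLevelCensusRamMTwoMult

open WithZero
open Literature.NumberTheory.Automorphic.UnitaryThreeFourFrame (IsRamifiedQuadraticDatum)
open Literature.NumberTheory.LocalFields.QuadraticOrder
open Summit.HodgeConjecture.HodgeConjecture.Cruxes.H413.F0P3cDyRamToricCensusDefs
open Summit.HodgeConjecture.HodgeConjecture.Cruxes.H413.F0P3cDyRamToricLevelCensusRamM

variable {K : Type} [Field K] [Valued K ℤᵐ⁰] {ρ Θ : K →+* K} {α ϖE h : K} {dρ t : ℕ}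

/-! ## §1 The `ρ`-depth of the depth unit is the distance of the lattice twist `θ` to `−ρμ∕μ` -/

/-- **THE `ρ`-DEPTH OF THE DEPTH UNIT, `jλ`-FREE (RamM tokens).**  For `x₀ ≠ 0`, `y = h·x₀Θx₀·ϖE^j(α − ρα)` with `|y| = |ϖE|^a`, `a ≤ m`, `|μ| = |ϖE|^m`, the unit
`z := μ∕(y·ϖE^{m−a})` has `|z − ρz| = |θ + ρμ∕μ|`, `θ := (ρh∕h)·(ρ(x₀Θx₀)∕(x₀Θx₀))` (`ρy = −θ·y` by ★ `map_hermGen_eq_neg_mul`; ★ `div_sub_map_div_eq`; `|z| = |θ| = 1`).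
[cite: Jacobowitz1962, §4] [cite: Serre1979, Ch. III §6 Prop. 12] -/
theorem v_depthUnit_sub_map_eq_twist_ramified (hD : IsRamifiedQuadraticDatum ρ α dρ t) (hρϖ : ρ ϖE = ϖE) (hϖE : Valued.v ϖE = exp (-2 : ℤ)) (hh : h ≠ 0)
    {μ : K} {m : ℕ} (hμ : Valued.v μ = Valued.v ϖE ^ m) {j a : ℕ} (ham : a ≤ m) {x₀ : K} (hx₀ : x₀ ≠ 0)
    (hya : Valued.v (h * (x₀ * Θ x₀) * (ϖE ^ j * (α - ρ α))) = Valued.v ϖE ^ a) :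
    Valued.v (μ / (h * (x₀ * Θ x₀) * (ϖE ^ j * (α - ρ α)) * ϖE ^ (m - a)) - ρ (μ / (h * (x₀ * Θ x₀) * (ϖE ^ j * (α - ρ α)) * ϖE ^ (m - a)))) =
      Valued.v (ρ h / h * (ρ (x₀ * Θ x₀) / (x₀ * Θ x₀)) + ρ μ / μ) := by
  obtain ⟨hρρ, hvρ, -, -, -, -, -⟩ := id hD
  have hϖ0 : ϖE ≠ 0 := fun h0 => by rw [h0, map_zero] at hϖE; exact exp_ne_zero hϖE.symm
  have hμ0 : μ ≠ 0 := fun h0 => by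
    rw [h0, map_zero, v_varpiE_pow hϖE] at hμ; exact exp_ne_zero hμ.symm
  have hΘx₀ : Θ x₀ ≠ 0 := (map_ne_zero Θ).2 hx₀
  have hN0 : x₀ * Θ x₀ ≠ 0 := mul_ne_zero hx₀ hΘx₀
  have hc : ρ (ϖE ^ j) = ϖE ^ j := by rw [map_pow, hρϖ]
  have hy0 : h * (x₀ * Θ x₀) * (ϖE ^ j * (α - ρ α)) ≠ 0 := fun h0 => by
    rw [h0, map_zero, v_varpiE_pow hϖE] at hya; exact exp_ne_zero hya.symm
  have hy'0 : h * (x₀ * Θ x₀) * (ϖE ^ j * (α - ρ α)) * ϖE ^ (m - a) ≠ 0 := mul_ne_zero hy0 (pow_ne_zero _ hϖ0)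
  -- `ρ y' = −θ·y'` for `y' = y·ϖE^{m−a}`
  have hρy := map_hermGen_eq_neg_mul (ρ := ρ) (Θ := Θ) (α := α) hρρ hc hh hx₀ hΘx₀
  have hρy' : ρ (h * (x₀ * Θ x₀) * (ϖE ^ j * (α - ρ α)) * ϖE ^ (m - a)) =
      -(ρ h / h * (ρ (x₀ * Θ x₀) / (x₀ * Θ x₀)) * (h * (x₀ * Θ x₀) * (ϖE ^ j * (α - ρ α)) * ϖE ^ (m - a))) := by
    rw [map_mul ρ _ (ϖE ^ (m - a)), map_pow, hρϖ, hρy]; ring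
  have hθ : Valued.v (ρ h / h * (ρ (x₀ * Θ x₀) / (x₀ * Θ x₀))) = 1 := by
    rw [map_mul, map_div₀, map_div₀, hvρ, hvρ, div_self ((Valuation.ne_zero_iff _).2 hh),
      div_self ((Valuation.ne_zero_iff _).2 hN0), mul_one]
  have hθ0 : ρ h / h * (ρ (x₀ * Θ x₀) / (x₀ * Θ x₀)) ≠ 0 := fun h0 => by rw [h0, map_zero] at hθ; exact zero_ne_one hθ
  have hvz : Valued.v (μ / (h * (x₀ * Θ x₀) * (ϖE ^ j * (α - ρ α)) * ϖE ^ (m - a))) = 1 := by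
    rw [map_div₀, map_mul, hya, map_pow, hμ, ← pow_add, Nat.add_sub_cancel' ham,
      div_self (pow_ne_zero _ ((Valuation.ne_zero_iff _).2 hϖ0))]
  rw [div_sub_map_div_eq (ρ := ρ) hρy' hθ0 hy'0 hμ0, map_mul, hvz, one_mul, map_div₀, hθ, div_one]

/-! ## §2 Two multipliers on one presented lattice: the deeper clause follows from the shallower one behind a lattice-free guard -/

/-- **TWO-MULTIPLIER DEPTH TEST, u-FREE, RamM TOKENS.**  For a presented member `Λ = x₀·𝒪_j` of `levelSet(j, a)` (`y = dualGen x₀`, `|y| = |ϖE|^a`) and two multipliers with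
`|μ₁| = |ϖE|^{m₁}`, `|μ₂| = |ϖE|^{m₂}`, `m₁ ≤ m₂` (so `μ₁` is the SHALLOWER one and its clause the binding one):
`(μ₁Λ^♯ ⊆ Λ ∧ μ₂Λ^♯ ⊆ Λ) ⟺ (μ₁Λ^♯ ⊆ Λ ∧ (j + a ≤ m₂ ∨ |ρμ₁∕μ₁ − ρμ₂∕μ₂| ≤ exp(2m₂ − 2a − 2j − d_ρ)))`.
By ★ (D0) each clause is `a ≤ mᵢ ∧ (j + a ≤ mᵢ ∨ |θ + ρμᵢ∕μᵢ| ≤ exp(2mᵢ − 2a − 2j − d_ρ))` with the SAME lattice twist `θ` (§1): two closed balls for `θ` with nested radii are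
nested (centres within the larger radius) or disjoint. [cite: Kottwitz1986BaseChangeUnits, §1 pp. 240–241] [cite: Jacobowitz1962, §4] [cite: Serre1979, Ch. II §1; Ch. III §6 Prop. 12] -/
theorem dep_and_dep_iff_of_witness_ramified (hD : IsRamifiedQuadraticDatum ρ α dρ t) (hΘΘ : ∀ x, Θ (Θ x) = x) (hΘρ : ∀ x, Θ (ρ x) = ρ (Θ x))
    (hvΘ : ∀ x, Valued.v (Θ x) = Valued.v x) (hρϖ : ρ ϖE = ϖE) (hϖE : Valued.v ϖE = exp (-2 : ℤ)) (hh : h ≠ 0)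
    {μ₁ μ₂ : K} {m₁ m₂ : ℕ} (hμ₁ : Valued.v μ₁ = Valued.v ϖE ^ m₁) (hμ₂ : Valued.v μ₂ = Valued.v ϖE ^ m₂) (hle : m₁ ≤ m₂)
    {j a : ℕ} {Λ : AddSubgroup K} {x₀ : K} (hx₀ : x₀ ≠ 0)
    (hΛ : ∀ x, x ∈ Λ ↔ ∃ z, IsOrd ρ α (ϖE ^ j) z ∧ x = x₀ * z) (hya : Valued.v (dualGen ρ Θ α (ϖE ^ j) h x₀) = Valued.v ϖE ^ a) :
    ((∀ b, (∀ x ∈ Λ, Valued.v (h * Θ x * b + ρ (h * Θ x * b)) ≤ 1) → μ₁ * b ∈ Λ) ∧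
        (∀ b, (∀ x ∈ Λ, Valued.v (h * Θ x * b + ρ (h * Θ x * b)) ≤ 1) → μ₂ * b ∈ Λ)) ↔
      ((∀ b, (∀ x ∈ Λ, Valued.v (h * Θ x * b + ρ (h * Θ x * b)) ≤ 1) → μ₁ * b ∈ Λ) ∧
        (j + a ≤ m₂ ∨ Valued.v (ρ μ₁ / μ₁ - ρ μ₂ / μ₂) ≤ exp (2 * (m₂ : ℤ) - 2 * a - 2 * j - dρ))) := by
  rw [dep_iff_of_witness_ramified hD hΘΘ hΘρ hvΘ hρϖ hϖE hh hμ₁ hx₀ hΛ hya,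
    dep_iff_of_witness_ramified hD hΘΘ hΘρ hvΘ hρϖ hϖE hh hμ₂ hx₀ hΛ hya]
  simp only [dualGen] at hya ⊢
  -- the two bounds are nested
  have hexp : exp (2 * (m₁ : ℤ) - 2 * a - 2 * j - dρ) ≤ exp (2 * (m₂ : ℤ) - 2 * a - 2 * j - dρ) := by
    rw [exp_le_exp]; omega
  -- names for the two depth units' twists
  set θ : K := ρ h / h * (ρ (x₀ * Θ x₀) / (x₀ * Θ x₀)) with hθdef
  constructor
  · rintro ⟨⟨ham₁, hor₁⟩, ⟨-, hor₂⟩⟩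
    refine ⟨⟨ham₁, hor₁⟩, ?_⟩
    by_cases hjam₂ : j + a ≤ m₂
    · exact Or.inl hjam₂
    right
    have ham₂ : a ≤ m₂ := le_trans ham₁ hle
    have h₁ : Valued.v (θ + ρ μ₁ / μ₁) ≤ exp (2 * (m₂ : ℤ) - 2 * a - 2 * j - dρ) := by
      rcases hor₁ with hjam₁ | hz₁
      · exfalso; omega
      · rw [v_depthUnit_sub_map_eq_twist_ramified hD hρϖ hϖE hh hμ₁ ham₁ hx₀ hya] at hz₁
        exact hz₁.trans hexp
    have h₂ : Valued.v (θ + ρ μ₂ / μ₂) ≤ exp (2 * (m₂ : ℤ) - 2 * a - 2 * j - dρ) := by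
      rcases hor₂ with hjam₂' | hz₂
      · exact absurd hjam₂' hjam₂
      · rwa [v_depthUnit_sub_map_eq_twist_ramified hD hρϖ hϖE hh hμ₂ ham₂ hx₀ hya] at hz₂
    have hsub : ρ μ₁ / μ₁ - ρ μ₂ / μ₂ = (θ + ρ μ₁ / μ₁) - (θ + ρ μ₂ / μ₂) := by ring
    rw [hsub]
    exact (Valuation.map_sub _ _ _).trans (max_le h₁ h₂)
  · rintro ⟨⟨ham₁, hor₁⟩, hG⟩
    have ham₂ : a ≤ m₂ := le_trans ham₁ hle
    refine ⟨⟨ham₁, hor₁⟩, ⟨ham₂, ?_⟩⟩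
    by_cases hjam₂ : j + a ≤ m₂
    · exact Or.inl hjam₂
    right
    have hguard : Valued.v (ρ μ₁ / μ₁ - ρ μ₂ / μ₂) ≤ exp (2 * (m₂ : ℤ) - 2 * a - 2 * j - dρ) := by
      rcases hG with hjam₂' | hG
      · exact absurd hjam₂' hjam₂
      · exact hG
    have h₁ : Valued.v (θ + ρ μ₁ / μ₁) ≤ exp (2 * (m₂ : ℤ) - 2 * a - 2 * j - dρ) := by
      rcases hor₁ with hjam₁ | hz₁
      · exfalso; omega
      · rw [v_depthUnit_sub_map_eq_twist_ramified hD hρϖ hϖE hh hμ₁ ham₁ hx₀ hya] at hz₁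
        exact hz₁.trans hexp
    rw [v_depthUnit_sub_map_eq_twist_ramified hD hρϖ hϖE hh hμ₂ ham₂ hx₀ hya]
    have hadd : θ + ρ μ₂ / μ₂ = (θ + ρ μ₁ / μ₁) - (ρ μ₁ / μ₁ - ρ μ₂ / μ₂) := by ring
    rw [hadd]
    exact (Valuation.map_sub _ _ _).trans (max_le h₁ hguard)

/-! ## §3 The two-multiplier cells of the RamM census -/

/-- **THE TWO-MULTIPLIER CELL IS A ONE-MULTIPLIER CELL OR EMPTY (RamM, set form).**  For `|μ₁| = |ϖE|^{m₁}`, `|μ₂| = |ϖE|^{m₂}`, `m₁ ≤ m₂` and every `(j, a)`: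
`levelSetDep(j,a;μ₁) ∩ levelSetDep(j,a;μ₂) = if (j + a ≤ m₂ ∨ |ρμ₁∕μ₁ − ρμ₂∕μ₂| ≤ exp(2m₂ − 2a − 2j − d_ρ)) then levelSetDep(j,a;μ₁) else ∅` — the guard is a letter of
`(j, a, μ₁, μ₂)`, not of the lattice (§2 on a witness of each member). [cite: Kottwitz1986BaseChangeUnits, §1 pp. 240–241] [cite: Jacobowitz1962, §4] [cite: Serre1979, Ch. II §1] -/
theorem levelSetDep_inter_levelSetDep_eq_ramified (hD : IsRamifiedQuadraticDatum ρ α dρ t) (hΘΘ : ∀ x, Θ (Θ x) = x) (hΘρ : ∀ x, Θ (ρ x) = ρ (Θ x))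
    (hvΘ : ∀ x, Valued.v (Θ x) = Valued.v x) (hρϖ : ρ ϖE = ϖE) (hϖE : Valued.v ϖE = exp (-2 : ℤ)) (hh : h ≠ 0)
    {μ₁ μ₂ : K} {m₁ m₂ : ℕ} (hμ₁ : Valued.v μ₁ = Valued.v ϖE ^ m₁) (hμ₂ : Valued.v μ₂ = Valued.v ϖE ^ m₂) (hle : m₁ ≤ m₂) (j a : ℕ) :
    levelSetDep ρ Θ α ϖE h j a μ₁ ∩ levelSetDep ρ Θ α ϖE h j a μ₂ =
      if j + a ≤ m₂ ∨ Valued.v (ρ μ₁ / μ₁ - ρ μ₂ / μ₂) ≤ exp (2 * (m₂ : ℤ) - 2 * a - 2 * j - dρ)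
      then levelSetDep ρ Θ α ϖE h j a μ₁ else ∅ := by
  ext Λ
  rw [Set.mem_inter_iff, mem_levelSetDep_iff, mem_levelSetDep_iff]
  constructor
  · rintro ⟨⟨hΛ, hdep₁⟩, ⟨-, hdep₂⟩⟩
    obtain ⟨x₀, hx₀, hΛx, hyO, hyN, hya⟩ := hΛ
    have hG := ((dep_and_dep_iff_of_witness_ramified hD hΘΘ hΘρ hvΘ hρϖ hϖE hh hμ₁ hμ₂ hle hx₀ hΛx hya).1 ⟨hdep₁, hdep₂⟩).2
    rw [if_pos hG, mem_levelSetDep_iff]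
    exact ⟨⟨x₀, hx₀, hΛx, hyO, hyN, hya⟩, hdep₁⟩
  · intro hΛ
    split_ifs at hΛ with hG
    · rw [mem_levelSetDep_iff] at hΛ
      obtain ⟨hΛ, hdep₁⟩ := hΛ
      obtain ⟨x₀, hx₀, hΛx, hyO, hyN, hya⟩ := hΛ
      have h2 := (dep_and_dep_iff_of_witness_ramified hD hΘΘ hΘρ hvΘ hρϖ hϖE hh hμ₁ hμ₂ hle hx₀ hΛx hya).2 ⟨hdep₁, hG⟩
      exact ⟨⟨⟨x₀, hx₀, hΛx, hyO, hyN, hya⟩, h2.1⟩, ⟨⟨x₀, hx₀, hΛx, hyO, hyN, hya⟩, h2.2⟩⟩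
    · exact absurd hΛ (Set.notMem_empty Λ)

/-- **THE (T5-P) SPELLING `levelSetDep(j,a;μ₁) ∩ {Λ ∣ μ₂·Λ^♯ ⊆ Λ}`** (LH4-p07 (g8) PRESCOPE-type2-rows §2 (L3), the square clause as a SECOND multiplier next to the first): the same
reduction — `= if GUARD then levelSetDep(j,a;μ₁) else ∅` (`m₁ ≤ m₂`). [cite: Kottwitz1986BaseChangeUnits, §1 pp. 240–241] [cite: Jacobowitz1962, §4] -/
theorem levelSetDep_inter_depth_eq_ramified (hD : IsRamifiedQuadraticDatum ρ α dρ t) (hΘΘ : ∀ x, Θ (Θ x) = x) (hΘρ : ∀ x, Θ (ρ x) = ρ (Θ x))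
    (hvΘ : ∀ x, Valued.v (Θ x) = Valued.v x) (hρϖ : ρ ϖE = ϖE) (hϖE : Valued.v ϖE = exp (-2 : ℤ)) (hh : h ≠ 0)
    {μ₁ μ₂ : K} {m₁ m₂ : ℕ} (hμ₁ : Valued.v μ₁ = Valued.v ϖE ^ m₁) (hμ₂ : Valued.v μ₂ = Valued.v ϖE ^ m₂) (hle : m₁ ≤ m₂) (j a : ℕ) :
    levelSetDep ρ Θ α ϖE h j a μ₁ ∩ {Λ | ∀ b, (∀ x ∈ Λ, Valued.v (h * Θ x * b + ρ (h * Θ x * b)) ≤ 1) → μ₂ * b ∈ Λ} =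
      if j + a ≤ m₂ ∨ Valued.v (ρ μ₁ / μ₁ - ρ μ₂ / μ₂) ≤ exp (2 * (m₂ : ℤ) - 2 * a - 2 * j - dρ)
      then levelSetDep ρ Θ α ϖE h j a μ₁ else ∅ := by
  rw [← levelSetDep_inter_levelSetDep_eq_ramified hD hΘΘ hΘρ hvΘ hρϖ hϖE hh hμ₁ hμ₂ hle j a]
  ext Λ
  simp only [Set.mem_inter_iff, Set.mem_setOf_eq, mem_levelSetDep_iff]
  exact ⟨fun ⟨⟨hΛ, h1⟩, h2⟩ => ⟨⟨hΛ, h1⟩, hΛ, h2⟩, fun ⟨⟨hΛ, h1⟩, _, h2⟩ => ⟨⟨hΛ, h1⟩, h2⟩⟩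

/-- **THE SHALLOWER MULTIPLIER ON THE RIGHT** (`m₂ ≤ m₁`): `levelSetDep(j,a;μ₁) ∩ levelSetDep(j,a;μ₂) = if GUARD′ then levelSetDep(j,a;μ₂) else ∅` with the guard read at `m₁`
(`Set.inter_comm` + §3). [cite: Kottwitz1986BaseChangeUnits, §1 pp. 240–241] -/
theorem levelSetDep_inter_levelSetDep_eq_ramified' (hD : IsRamifiedQuadraticDatum ρ α dρ t) (hΘΘ : ∀ x, Θ (Θ x) = x) (hΘρ : ∀ x, Θ (ρ x) = ρ (Θ x))
    (hvΘ : ∀ x, Valued.v (Θ x) = Valued.v x) (hρϖ : ρ ϖE = ϖE) (hϖE : Valued.v ϖE = exp (-2 : ℤ)) (hh : h ≠ 0)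
    {μ₁ μ₂ : K} {m₁ m₂ : ℕ} (hμ₁ : Valued.v μ₁ = Valued.v ϖE ^ m₁) (hμ₂ : Valued.v μ₂ = Valued.v ϖE ^ m₂) (hle : m₂ ≤ m₁) (j a : ℕ) :
    levelSetDep ρ Θ α ϖE h j a μ₁ ∩ levelSetDep ρ Θ α ϖE h j a μ₂ =
      if j + a ≤ m₁ ∨ Valued.v (ρ μ₂ / μ₂ - ρ μ₁ / μ₁) ≤ exp (2 * (m₁ : ℤ) - 2 * a - 2 * j - dρ)
      then levelSetDep ρ Θ α ϖE h j a μ₂ else ∅ := by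
  rw [Set.inter_comm]
  exact levelSetDep_inter_levelSetDep_eq_ramified hD hΘΘ hΘρ hvΘ hρϖ hϖE hh hμ₂ hμ₁ hle j a

/-- **THE TWO-MULTIPLIER CELL, COUNTED**: `#(levelSetDep(j,a;μ₁) ∩ levelSetDep(j,a;μ₂)) = if GUARD then #levelSetDep(j,a;μ₁) else 0` (`m₁ ≤ m₂`) — every two-multiplier
RamM table is the ★ one-multiplier table of the shallower multiplier behind the guard. [cite: Flicker1998UnitaryFL, Prop. 7 p. 84] [cite: Kottwitz1986BaseChangeUnits, §1 pp. 240–241] -/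
theorem ncard_levelSetDep_inter_eq_ramified (hD : IsRamifiedQuadraticDatum ρ α dρ t) (hΘΘ : ∀ x, Θ (Θ x) = x) (hΘρ : ∀ x, Θ (ρ x) = ρ (Θ x))
    (hvΘ : ∀ x, Valued.v (Θ x) = Valued.v x) (hρϖ : ρ ϖE = ϖE) (hϖE : Valued.v ϖE = exp (-2 : ℤ)) (hh : h ≠ 0)
    {μ₁ μ₂ : K} {m₁ m₂ : ℕ} (hμ₁ : Valued.v μ₁ = Valued.v ϖE ^ m₁) (hμ₂ : Valued.v μ₂ = Valued.v ϖE ^ m₂) (hle : m₁ ≤ m₂) (j a : ℕ) :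
    (levelSetDep ρ Θ α ϖE h j a μ₁ ∩ levelSetDep ρ Θ α ϖE h j a μ₂).ncard =
      if j + a ≤ m₂ ∨ Valued.v (ρ μ₁ / μ₁ - ρ μ₂ / μ₂) ≤ exp (2 * (m₂ : ℤ) - 2 * a - 2 * j - dρ)
      then (levelSetDep ρ Θ α ϖE h j a μ₁).ncard else 0 := by
  rw [levelSetDep_inter_levelSetDep_eq_ramified hD hΘΘ hΘρ hvΘ hρϖ hϖE hh hμ₁ hμ₂ hle j a]
  split_ifs
  · rfl
  · exact Set.ncard_empty _

/-! ## §4 … composed with the ★ generic one-multiplier rule (D1)(D2) -/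

/-- **THE TWO-MULTIPLIER TABLE OFF THE COINCIDENCE DIAGONAL OF THE SHALLOWER MULTIPLIER** (★ `levelSetDep_eq_of_generic_ramified` behind the guard): with the tree token
`|μ₁ − ρμ₁| = |ϖE^{jλ₁}(α − ρα)|`, `j ≤ jλ₁`, and `j + m₁ ≠ jλ₁ + a ∨ GEN(μ₁)`:
`#(levelSetDep(j,a;μ₁) ∩ levelSetDep(j,a;μ₂)) = [GUARD]·[GEN(μ₁)]·#levelSet(j,a)`, `GEN(μ₁) := a ≤ m₁ ∧ (j ≤ m₁ − a ∨ (2a ≤ m₁ ∧ j + a ≤ jλ₁))`; `#levelSet(j,a)` is the ★ `+` table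
`ncard_levelSet_eq_hnP`.  (On the diagonal the ★ (D3) top cells `…RamMTop*` of `μ₁` take the place of `[GEN]·#levelSet`, behind the same guard — §3.)
[cite: Flicker1998UnitaryFL, Prop. 7 p. 84] [cite: Kottwitz1986BaseChangeUnits, §1 pp. 240–241] [cite: Jacobowitz1962, §4] -/
theorem ncard_levelSetDep_inter_eq_of_generic_ramified (hD : IsRamifiedQuadraticDatum ρ α dρ t) (hΘΘ : ∀ x, Θ (Θ x) = x) (hΘρ : ∀ x, Θ (ρ x) = ρ (Θ x))
    (hvΘ : ∀ x, Valued.v (Θ x) = Valued.v x) (hρϖ : ρ ϖE = ϖE) (hϖE : Valued.v ϖE = exp (-2 : ℤ)) (hh : h ≠ 0)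
    {μ₁ μ₂ : K} {m₁ m₂ jl₁ : ℕ} (hμ₁ : Valued.v μ₁ = Valued.v ϖE ^ m₁) (hjl₁ : Valued.v (μ₁ - ρ μ₁) = Valued.v (ϖE ^ jl₁ * (α - ρ α)))
    (hμ₂ : Valued.v μ₂ = Valued.v ϖE ^ m₂) (hle : m₁ ≤ m₂)
    {j a : ℕ} (hj : j ≤ jl₁) (hoff : j + m₁ ≠ jl₁ + a ∨ (a ≤ m₁ ∧ (j ≤ m₁ - a ∨ (2 * a ≤ m₁ ∧ j + a ≤ jl₁)))) :
    (levelSetDep ρ Θ α ϖE h j a μ₁ ∩ levelSetDep ρ Θ α ϖE h j a μ₂).ncard =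
      if j + a ≤ m₂ ∨ Valued.v (ρ μ₁ / μ₁ - ρ μ₂ / μ₂) ≤ exp (2 * (m₂ : ℤ) - 2 * a - 2 * j - dρ)
      then (if a ≤ m₁ ∧ (j ≤ m₁ - a ∨ (2 * a ≤ m₁ ∧ j + a ≤ jl₁)) then (levelSet ρ Θ α ϖE h j a).ncard else 0) else 0 := by
  rw [ncard_levelSetDep_inter_eq_ramified hD hΘΘ hΘρ hvΘ hρϖ hϖE hh hμ₁ hμ₂ hle j a,
    ncard_levelSetDep_eq_of_generic_ramified hD hΘΘ hΘρ hvΘ hρϖ hϖE hh hμ₁ hjl₁ hj hoff]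

/-! ## §5 The guard letter for a pair `(μ∕c, μ·ν∕c′)` with `ρ`-fixed scalings -/

omit [Valued K ℤᵐ⁰] in
/-- **`ρ`-TWISTS IGNORE `ρ`-FIXED SCALINGS**: `ρ(μ∕c)∕(μ∕c) = ρμ∕μ` and `ρ(μ·ν∕c′)∕(μ·ν∕c′) = (ρμ∕μ)·(ρν∕ν)` for `ρc = c`, `ρc′ = c′`, all non-zero; hence
`ρ(μ∕c)∕(μ∕c) − ρ(μν∕c′)∕(μν∕c′) = (ρμ∕μ)·(1 − ρν∕ν)`. [cite: Serre1979, Ch. III §6 Prop. 12] -/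
theorem map_div_sub_map_div_of_fixed {μ ν c c' : K} (hμ : μ ≠ 0) (hν : ν ≠ 0) (hc : c ≠ 0) (hc' : c' ≠ 0) (hρc : ρ c = c) (hρc' : ρ c' = c') :
    ρ (μ / c) / (μ / c) - ρ (μ * ν / c') / (μ * ν / c') = ρ μ / μ * (1 - ρ ν / ν) := by
  rw [map_div₀, map_div₀, map_mul, hρc, hρc']
  field_simp

/-- **THE GUARD LETTER OF THE PAIR OF RECORD**: for `μ₁ = μ∕c`, `μ₂ = μ·ν∕c′` (`c, c′` `ρ`-fixed — the powers of `ϖE` of the depth and square tokens; `ν = μ + 2(u − 1)` for the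
square clause), `|ρμ₁∕μ₁ − ρμ₂∕μ₂| = |ν − ρν| ∕ |ν|` — a token of the element alone (`|ρμ∕μ| = 1` for an isometric `ρ`). [cite: Serre1979, Ch. III §6 Prop. 12] -/
theorem v_twist_sub_twist_eq (hvρ : ∀ x, Valued.v (ρ x) = Valued.v x) {μ ν c c' : K} (hμ : μ ≠ 0) (hν : ν ≠ 0) (hc : c ≠ 0) (hc' : c' ≠ 0)
    (hρc : ρ c = c) (hρc' : ρ c' = c') :
    Valued.v (ρ (μ / c) / (μ / c) - ρ (μ * ν / c') / (μ * ν / c')) = Valued.v (ν - ρ ν) / Valued.v ν := by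
  rw [map_div_sub_map_div_of_fixed (ρ := ρ) hμ hν hc hc' hρc hρc', map_mul, map_div₀, hvρ,
    div_self ((Valuation.ne_zero_iff _).2 hμ), one_mul, one_sub_div hν, map_div₀, ← Valuation.map_neg _ (ν - ρ ν), neg_sub]

/-! ## §6 (ED. 2) The WEIGHTED two-multiplier cone cell — the shape ★ (C1) ∕ ★ p858894 actually sum (LH4-p07 (g8) ROW-(2) LETTERS 09:17:19Z (i)) -/

/-- **THE WEIGHTED TWO-MULTIPLIER CONE CELL (RamM)** — ED. 2, for the letters of record of row (2) (LH4-p07 (g8) 09:17:19Z (i): the square-token cone cells of ★ (C1)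
p857559 ∕ ★ p858894 are `levelSetDep(j, b; lam − jE u₀₀) ∩ levelSetDep(j, b; (jE c)⁻¹((lam − 1)² − (jE u₀₀ − 1)²))`, summed with the ★ T1 norm-residue WEIGHTS
`f b j Λ = #Sol_{2b}(r_Λ)` — a `Σᶠ` over the cell, not only its cardinality): for ANY weight `f` into an additive commutative monoid and `m₁ ≤ m₂`,
`Σᶠ_{Λ ∈ levelSetDep(j,a;μ₁) ∩ levelSetDep(j,a;μ₂)} f Λ = if GUARD then Σᶠ_{Λ ∈ levelSetDep(j,a;μ₁)} f Λ else 0` — so every weighted two-multiplier RamM cone sum is the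
★ one-multiplier O-Cone ∕ O-Sum term of the shallower multiplier behind the guard (§3 set identity; `finsum_mem_empty`).
[cite: Kottwitz1986BaseChangeUnits, §1 pp. 240–241] [cite: Jacobowitz1962, §4] [cite: Serre1979, Ch. II §1] -/
theorem finsum_mem_inter_levelSetDep_eq_ramified (hD : IsRamifiedQuadraticDatum ρ α dρ t) (hΘΘ : ∀ x, Θ (Θ x) = x) (hΘρ : ∀ x, Θ (ρ x) = ρ (Θ x))
    (hvΘ : ∀ x, Valued.v (Θ x) = Valued.v x) (hρϖ : ρ ϖE = ϖE) (hϖE : Valued.v ϖE = exp (-2 : ℤ)) (hh : h ≠ 0)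
    {μ₁ μ₂ : K} {m₁ m₂ : ℕ} (hμ₁ : Valued.v μ₁ = Valued.v ϖE ^ m₁) (hμ₂ : Valued.v μ₂ = Valued.v ϖE ^ m₂) (hle : m₁ ≤ m₂) (j a : ℕ)
    {M : Type*} [AddCommMonoid M] (f : AddSubgroup K → M) :
    ∑ᶠ Λ ∈ levelSetDep ρ Θ α ϖE h j a μ₁ ∩ levelSetDep ρ Θ α ϖE h j a μ₂, f Λ =
      if j + a ≤ m₂ ∨ Valued.v (ρ μ₁ / μ₁ - ρ μ₂ / μ₂) ≤ exp (2 * (m₂ : ℤ) - 2 * a - 2 * j - dρ)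
      then ∑ᶠ Λ ∈ levelSetDep ρ Θ α ϖE h j a μ₁, f Λ else 0 := by
  rw [levelSetDep_inter_levelSetDep_eq_ramified hD hΘΘ hΘρ hvΘ hρϖ hϖE hh hμ₁ hμ₂ hle j a]
  split_ifs
  · rfl
  · exact finsum_mem_empty

/-- **THE WEIGHTED CELL IN THE (T5-P) SPELLING** `levelSetDep(j,a;μ₁) ∩ {Λ ∣ μ₂·Λ^♯ ⊆ Λ}` (the second multiplier as a bare depth clause): the same weighted reduction.
[cite: Kottwitz1986BaseChangeUnits, §1 pp. 240–241] [cite: Jacobowitz1962, §4] -/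
theorem finsum_mem_levelSetDep_inter_depth_eq_ramified (hD : IsRamifiedQuadraticDatum ρ α dρ t) (hΘΘ : ∀ x, Θ (Θ x) = x) (hΘρ : ∀ x, Θ (ρ x) = ρ (Θ x))
    (hvΘ : ∀ x, Valued.v (Θ x) = Valued.v x) (hρϖ : ρ ϖE = ϖE) (hϖE : Valued.v ϖE = exp (-2 : ℤ)) (hh : h ≠ 0)
    {μ₁ μ₂ : K} {m₁ m₂ : ℕ} (hμ₁ : Valued.v μ₁ = Valued.v ϖE ^ m₁) (hμ₂ : Valued.v μ₂ = Valued.v ϖE ^ m₂) (hle : m₁ ≤ m₂) (j a : ℕ)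
    {M : Type*} [AddCommMonoid M] (f : AddSubgroup K → M) :
    ∑ᶠ Λ ∈ levelSetDep ρ Θ α ϖE h j a μ₁ ∩ {Λ | ∀ b, (∀ x ∈ Λ, Valued.v (h * Θ x * b + ρ (h * Θ x * b)) ≤ 1) → μ₂ * b ∈ Λ}, f Λ =
      if j + a ≤ m₂ ∨ Valued.v (ρ μ₁ / μ₁ - ρ μ₂ / μ₂) ≤ exp (2 * (m₂ : ℤ) - 2 * a - 2 * j - dρ)
      then ∑ᶠ Λ ∈ levelSetDep ρ Θ α ϖE h j a μ₁, f Λ else 0 := by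
  rw [levelSetDep_inter_depth_eq_ramified hD hΘΘ hΘρ hvΘ hρϖ hϖE hh hμ₁ hμ₂ hle j a]
  split_ifs
  · rfl
  · exact finsum_mem_empty

end Summit.HodgeConjecture.HodgeConjecture.Cruxes.H413.F0P3cDyRamToricLevelCensusRamMTwoMult

end
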